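import Summits.NavierStokesRegularity.FluidComputer.PalasekTowerShadowedRun

/-!
# THE SHADOWED RUN, II: the free run next to an approximate run; the a-posteriori form with a
# classical pseudo-solution and its residual; continuous dependence on the datum with existence

Cell `ns-blowup`, seat `ns-blowup-fc-prover-3` (g9; D-0074 GROUP C «BRIDGE SUPPORT»; bears_on LADDER-NS N1,
route `PalasekTowerBreakdown`, crux `EpisodeBase` = item stmt-NavierStokesRegularity-19179, line `slot` v5,
stub `stub_explicit_slice_run : ExplicitSliceRun`). LABEL: E–C typing + kernel analysis (theorems only; no
definition, no named fact, no `sorry`). WHAT THIS IS NOT: not Navier–Stokes evidence — existence-and-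
closeness next to a GIVEN field on a FIXED slab; no run, approximate run, host or blow-up is exhibited.

Corollaries of `ShadowedRun.exists_free_run_near_mildRef` (part I, §3):

* **`exists_free_run_near_pseudoRun`** — THE A-POSTERIORI FORM: the reference is a classical solution
  `(w, ϖ)` of the system FORCED BY ITS OWN RESIDUAL `r = ∂ₜw − νΔw + (w·∇)w + ∇ϖ` (jointly continuous,
  bounded, weakly divergence-free slices, `‖r(t)‖₂ ≤ G`), of finite energy, `‖w‖ ≤ M`:
  `2 (D + 4 ν^{-3/4} T^{1/4} G) e^{36 C₀² (2M+1)² T/ν} ≤ 1/2` ⇒ a FREE classical run from `a` exists on the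
  whole slab within that distance of `w` — regularity AND location of the true flow on `[0, T]` verified
  from the approximate flow alone (the `ℝ³`, sup-norm twin of the tree's
  `Torus.classicalNS_regular_of_approximation`; Dashti–Robinson 2008 Thm 5, Chernyshenko–Constantin–
  Robinson–Titi 2007, Robinson–Rodrigo–Sadowski 2016 Ex. 9.6);
* `exists_free_run_near_free_run_of_datum` — continuous dependence on the datum WITH existence (free
  exact reference run, perturbed Clay datum).

References: J. Leray, Acta Math. 63 (1934) §19 [cite: Leray1934, §19 (3.4)–(3.8)]; T. Tao, Anal. PDE 6
(2013) Thm. 5.4 [cite: Tao2011, Thm. 5.4 (ii)+(iv)]; M. Dashti, J. C. Robinson, SIAM J. Numer. Anal. 46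
(2008) [cite: DashtiRobinson2008, Thm. 5]; S. I. Chernyshenko, P. Constantin, J. C. Robinson, E. S. Titi,
J. Math. Phys. 48 (2007) 065204 [cite: ChernyshenkoConstantinRobinsonTiti2007, Thm. 2]; S. Palasek,
arXiv:2605.13827 §4 [cite: Palasek2026ElementaryModel, §4].
-/

noncomputable section

namespace Summit.NavierStokesRegularity.FluidComputer.PalasekTowerClayBridge.ShadowedRun

open Set MeasureTheory Filter Topology Function
open scoped ENNReal NNReal ContDiff
open Literature.Analysis Literature.Analysis.FluidPDE

/-! ## §3 Corollaries: the free run; the a-posteriori form (pseudo-solution); datum perturbation -/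

section Corollaries

variable {ν T M F D G : ℝ}
  {w Φ r : ℝ → EuclideanSpace ℝ (Fin 3) → EuclideanSpace ℝ (Fin 3)}
  {ϖ : ℝ → EuclideanSpace ℝ (Fin 3) → ℝ}
  {a : EuclideanSpace ℝ (Fin 3) → EuclideanSpace ℝ (Fin 3)}

/-- **THE A-POSTERIORI FORM (a pseudo-solution shadows a free run).** Let `(w, π)` be a classical
solution on `[0, T] × ℝ³` (`ν > 0`, `T > 0`) of the Navier–Stokes system FORCED BY `r` — read: `w` is an
APPROXIMATE free run and `r = ∂ₜw − νΔw + (w·∇)w + ∇π` its RESIDUAL — with finite energy, `‖w‖ ≤ M`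
(`M > 0`), the residual jointly continuous, bounded, with weakly divergence-free slices and
`‖r(t)‖₂ ≤ G` on `[0, T]` (`G ≥ 0`); let `a` be a Clay datum with `‖a − w(0)‖ ≤ D`. If
`2 (D + 4 ν^{-3/4} T^{1/4} G) exp (36 C₀² (M+(M+1))² T / ν) ≤ 1/2` then the UNFORCED system has a classical
finite-energy solution `(u', p')` on `[0, T] × ℝ³` with `u' 0 = a` and
`‖u'(t,x) − w(t,x)‖ ≤ 2 (D + 4 ν^{-3/4} T^{1/4} G) exp (36 C₀² (M+(M+1))² t / ν)`: regularity of the true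
flow on `[0, T]` is verified from the approximate flow alone. (The reference obeys the Oseen identity
with remainder the heat Duhamel integral of `r`, `IsClassicalNSSolutionOn.ae_eq_forced_oseenMild`, of size
`≤ 4 ν^{-3/4} T^{1/4} G`, `norm_forceDuhamel_le_of_eLpNorm_two`.) [cite: DashtiRobinson2008, Thm. 5]
[cite: ChernyshenkoConstantinRobinsonTiti2007, Thm. 2] [cite: Leray1934, §19 (3.4)–(3.8)] -/
theorem exists_free_run_near_pseudoRun (hν : 0 < ν) (hT : 0 < T)
    (hw : IsClassicalNSSolutionOn (Icc 0 T) ν r w ϖ)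
    (hwE : ∃ C : ℝ≥0∞, C < ⊤ ∧ ∀ t ∈ Icc 0 T, ∫⁻ x, ‖w t x‖ₑ ^ 2 ≤ C)
    (hM : 0 < M) (hbd : ∀ t ∈ Icc 0 T, ∀ y, ‖w t y‖ ≤ M)
    (hrc : Continuous (uncurry r)) {R : ℝ} (hR : ∀ τ ∈ Icc 0 T, ∀ y, ‖r τ y‖ ≤ R)
    (hrdiv : ∀ τ ∈ Icc 0 T, IsWeaklyDivFree (r τ))
    (hG : 0 ≤ G) (hr2 : ∀ τ ∈ Icc 0 T, eLpNorm (r τ) 2 volume ≤ ENNReal.ofReal G)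
    (ha_smooth : ContDiff ℝ ∞ a) (ha_div : VectorCalculus.IsDivFree a) (ha0 : HasRapidSpatialDecay a)
    (hD : ∀ y, ‖a y - w 0 y‖ ≤ D)
    (hΨ : 2 * (D + 4 * ν ^ (-(3 / 4 : ℝ)) * T ^ (1 / 4 : ℝ) * G) *
      Real.exp (36 * oseenSliceConst (EuclideanSpace ℝ (Fin 3)) ^ 2 * (M + (M + 1)) ^ 2 / ν * T) ≤
        1 / 2) :
    ∃ (u' : ℝ → EuclideanSpace ℝ (Fin 3) → EuclideanSpace ℝ (Fin 3))
      (p' : ℝ → EuclideanSpace ℝ (Fin 3) → ℝ),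
      IsClassicalNSSolutionOn (Icc 0 T) ν 0 u' p' ∧ u' 0 = a ∧
      (∃ C : ℝ≥0∞, C < ⊤ ∧ ∀ t ∈ Icc 0 T, ∫⁻ x, ‖u' t x‖ₑ ^ 2 ≤ C) ∧
      ∀ t ∈ Icc 0 T, ∀ x, ‖u' t x - w t x‖ ≤
        2 * (D + 4 * ν ^ (-(3 / 4 : ℝ)) * T ^ (1 / 4 : ℝ) * G) *
          Real.exp (36 * oseenSliceConst (EuclideanSpace ℝ (Fin 3)) ^ 2 * (M + (M + 1)) ^ 2 / ν * t) := by
  -- the reference at the mild level: remainder = heat Duhamel integral of the residual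
  set F : ℝ := 4 * ν ^ (-(3 / 4 : ℝ)) * T ^ (1 / 4 : ℝ) * G with hF_def
  have hF0 : 0 ≤ F := by positivity
  have hslc : ∀ t ∈ Icc 0 T, Continuous (w t) := fun t ht => (hw.contDiff_velocity ht).continuous
  have hmeas : AEStronglyMeasurable (uncurry w)
      ((volume : Measure (ℝ × EuclideanSpace ℝ (Fin 3))).restrict (Ioo 0 T ×ˢ univ)) := by
    have hcont : ContinuousOn (uncurry w) (Icc 0 T ×ˢ univ) := hw.smooth_velocity.continuousOn
    exact (hcont.mono (prod_mono Ioo_subset_Icc_self subset_rfl)).aestronglyMeasurable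
      (measurableSet_Ioo.prod MeasurableSet.univ)
  have hrslc : ∀ τ, Continuous (r τ) := fun τ => hrc.comp (continuous_const.prodMk continuous_id)
  have hrep : ∀ t ∈ Ioc 0 T, w t =ᵐ[volume] fun x =>
      UnboundedOperators.heatExtension (w 0) (ν * t) x - oseenDuhamel ν 0 w w t x +
        forceDuhamel ν 0 r t x :=
    fun t ht => hw.ae_eq_forced_oseenMild hν hT hrc hR hrdiv ENNReal.ofReal_ne_top hr2 hwE hM hbd ht
  have hF : ∀ t ∈ Ioc 0 T, ∀ x, ‖forceDuhamel ν 0 r t x‖ ≤ F := by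
    intro t ht x
    have hmem : ∀ τ ∈ Ioo 0 t, MemLp (r τ) 2 volume := fun τ hτ =>
      ⟨(hrslc τ).aestronglyMeasurable,
        (hr2 τ ⟨hτ.1.le, hτ.2.le.trans ht.2⟩).trans_lt ENNReal.ofReal_lt_top⟩
    have h2 : ∀ τ ∈ Ioo 0 t, eLpNorm (r τ) 2 volume ≤ ENNReal.ofReal G := fun τ hτ =>
      hr2 τ ⟨hτ.1.le, hτ.2.le.trans ht.2⟩
    have h1 : t ^ (1 / 4 : ℝ) ≤ T ^ (1 / 4 : ℝ) := Real.rpow_le_rpow ht.1.le ht.2 (by norm_num)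
    refine (norm_forceDuhamel_le_of_eLpNorm_two hν ht.1 hG hmem h2 x).trans ?_
    rw [hF_def]
    gcongr
  obtain ⟨u', p', hcl', hu'0, hE', hclose⟩ :=
    exists_free_run_near_mildRef hν hT hslc hmeas hM hbd hrep hF0 hF ha_smooth ha_div ha0 hD
      (by rw [hF_def]; exact hΨ)
  exact ⟨u', p', hcl', hu'0, hE', hclose⟩

/-- **Continuous dependence on the datum WITH existence (free reference run).** Let `(v, q)` be a
classical finite-energy solution of the UNFORCED system on `[0, T] × ℝ³` (`ν > 0`), `‖v‖ ≤ M`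
(`M > 0`), and let `a` be a Clay datum with `‖a − v(0)‖ ≤ D`. If `2 D exp (36 C₀² (M+(M+1))² T / ν) ≤ 1/2`
then the unforced system has a classical finite-energy solution on `[0, T] × ℝ³` from `a`, within
`2 D exp (36 C₀² (M+(M+1))² t / ν)` of `v`. [cite: Leray1934, §19 (3.4)–(3.8)] [cite: Tao2011, Thm. 5.4 (ii)+(iv)] -/
theorem exists_free_run_near_free_run_of_datum (hν : 0 < ν) (hT : 0 < T)
    {v : ℝ → EuclideanSpace ℝ (Fin 3) → EuclideanSpace ℝ (Fin 3)} {q : ℝ → EuclideanSpace ℝ (Fin 3) → ℝ}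
    (hv : IsClassicalNSSolutionOn (Icc 0 T) ν 0 v q)
    (hvE : ∃ C : ℝ≥0∞, C < ⊤ ∧ ∀ t ∈ Icc 0 T, ∫⁻ x, ‖v t x‖ₑ ^ 2 ≤ C)
    (hM : 0 < M) (hbd : ∀ t ∈ Icc 0 T, ∀ y, ‖v t y‖ ≤ M)
    (ha_smooth : ContDiff ℝ ∞ a) (ha_div : VectorCalculus.IsDivFree a) (ha0 : HasRapidSpatialDecay a)
    (hD : ∀ y, ‖a y - v 0 y‖ ≤ D)
    (hΨ : 2 * D *
      Real.exp (36 * oseenSliceConst (EuclideanSpace ℝ (Fin 3)) ^ 2 * (M + (M + 1)) ^ 2 / ν * T) ≤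
        1 / 2) :
    ∃ (u' : ℝ → EuclideanSpace ℝ (Fin 3) → EuclideanSpace ℝ (Fin 3))
      (p' : ℝ → EuclideanSpace ℝ (Fin 3) → ℝ),
      IsClassicalNSSolutionOn (Icc 0 T) ν 0 u' p' ∧ u' 0 = a ∧
      (∃ C : ℝ≥0∞, C < ⊤ ∧ ∀ t ∈ Icc 0 T, ∫⁻ x, ‖u' t x‖ₑ ^ 2 ≤ C) ∧
      ∀ t ∈ Icc 0 T, ∀ x, ‖u' t x - v t x‖ ≤
        2 * D * Real.exp (36 * oseenSliceConst (EuclideanSpace ℝ (Fin 3)) ^ 2 * (M + (M + 1)) ^ 2 / ν * t) := by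
  have hzc : Continuous (uncurry (0 : ℝ → EuclideanSpace ℝ (Fin 3) → EuclideanSpace ℝ (Fin 3))) :=
    continuous_const
  have hzb : ∀ τ ∈ Icc 0 T, ∀ y,
      ‖(0 : ℝ → EuclideanSpace ℝ (Fin 3) → EuclideanSpace ℝ (Fin 3)) τ y‖ ≤ 0 := fun τ _ y => by simp
  have hzdiv : ∀ τ ∈ Icc 0 T,
      IsWeaklyDivFree ((0 : ℝ → EuclideanSpace ℝ (Fin 3) → EuclideanSpace ℝ (Fin 3)) τ) :=
    fun τ _ θ _ => by simp
  have hz2 : ∀ τ ∈ Icc 0 T,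
      eLpNorm ((0 : ℝ → EuclideanSpace ℝ (Fin 3) → EuclideanSpace ℝ (Fin 3)) τ) 2 volume ≤
        ENNReal.ofReal 0 := fun τ _ => by
    have h : (0 : ℝ → EuclideanSpace ℝ (Fin 3) → EuclideanSpace ℝ (Fin 3)) τ = 0 := rfl
    rw [h, eLpNorm_zero]
    exact bot_le
  have hzero : D + 4 * ν ^ (-(3 / 4 : ℝ)) * T ^ (1 / 4 : ℝ) * 0 = D := by ring
  have hΨ' : 2 * (D + 4 * ν ^ (-(3 / 4 : ℝ)) * T ^ (1 / 4 : ℝ) * 0) *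
      Real.exp (36 * oseenSliceConst (EuclideanSpace ℝ (Fin 3)) ^ 2 * (M + (M + 1)) ^ 2 / ν * T) ≤
        1 / 2 := by rw [hzero]; exact hΨ
  obtain ⟨u', p', hcl', hu'0, hE', hclose⟩ :=
    exists_free_run_near_pseudoRun hν hT hv hvE hM hbd hzc hzb hzdiv le_rfl hz2 ha_smooth ha_div ha0
      hD hΨ'
  refine ⟨u', p', hcl', hu'0, hE', fun t ht x => ?_⟩
  have h := hclose t ht x
  rwa [hzero] at h

end Corollaries

end Summit.NavierStokesRegularity.FluidComputer.PalasekTowerClayBridge.ShadowedRun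

end
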